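import Summits.ResolutionOfSingularities.ResolutionOfSingularities.Theorems.WildQuotientsWildQuotientResolutionS1aCentreNeBot
import Literature.AlgebraicGeometry.Resolution.ComponentGluing

/-!
# S1a — H4e: the GAME FRAME — models, terminal atlases, strategies, and the `KillTameModel` ASSEMBLY
[OURS · L1 W4.5c · idea-2 g15]

NOT a statement of the manuscript; counted 0. AI-level work, weaker than expert review. H3-SCHEME memo (G4)–(G6).

* `GModel p q G ρ g₀` — a `G`-MODEL of the datum `(q : X′ → X₁, ρ)`: `π : V → X′` proper birational, `V` integral and
  locally Noetherian, an action over `X₁` along `r = π ≫ q` making `π` equivariant, and a NODE ATLAS (H4b);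
* `GModel.Terminal M` — every point has a stable affine node-free END chart: the ring of invariants
  `Γ(O)^G` (tree `ActionOver.invariantsRing`) is a TAME ROOT CHART (D2-T) — the local END condition fed by H1/H2;
* `GModel.IsMoveOf M M′ 𝒦 d` — `M′` is obtained from `M` by a blow-up of `𝒦.ideal d`, equivariantly;
* `EndGluing` — (G5) the pure GLUING residue: terminal cover ⇒ `LocallyTameRootRegular act.glued`;
* `Strategy p q G ρ g₀` — (G6) = THE TERMINATION CRUX in scheme language: a measure `μ : GModel → ℕ` and, for every
  non-terminal model, an ADMISSIBLE CENTRE all of whose moves decrease `μ`;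
* **`killTameModel_of : (∀ g, g ∈ zpowers g₀) → MoveStep p → EndGluing → Strategy p q G ρ g₀ → GModel p q G ρ g₀ →
  KillTameModel q G ρ`** — PROVED (for `G = ⟨g₀⟩`, tri-2/tri-1 (J-G); strong induction on `μ`; each move re-packaged as a model by the tree: `IsProper` composition,
  `ComponentGluing.IsBirational.comp`, equivariance diagram);
* `GModel.initial` — the initial model `V = X′` from a node atlas on `X′` itself (INITIAL-ATLAS residue: on
  `q⁻¹(W)`, `W ⊆ X₁` affine, the regular ring `Γ(X′, q⁻¹W)` with the TRIVIAL grading `m = 0` is a tame node).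
-/

set_option linter.dupNamespace false

noncomputable section

open CategoryTheory AlgebraicGeometry TopologicalSpace
open Literature.AlgebraicGeometry.Resolution Literature.AlgebraicGeometry.RelativeSpec
open Summit.ResolutionOfSingularities.ResolutionOfSingularities.Theorems.WildQuotientResolution.S1
open Summit.ResolutionOfSingularities.ResolutionOfSingularities.Theorems.WildQuotientResolution.S1.NodeAtlas
open Summit.ResolutionOfSingularities.ResolutionOfSingularities.Theorems.WildQuotientResolution.S1.MoveStep
open Summit.ResolutionOfSingularities.ResolutionOfSingularities.Theorems.WildQuotientResolution.S1.CentreNeBot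

namespace Summit.ResolutionOfSingularities.ResolutionOfSingularities.Theorems.WildQuotientResolution.S1.GameFrame

variable (p : ℕ) {X' X₁ : Scheme.{0}} (q : X' ⟶ X₁) (G : Type) [Group G] (ρ : G →* Aut X') (g₀ : G)

/-- **`G`-model** of the datum `(q, ρ)`: a proper birational `π : V → X′` from an integral locally Noetherian `V`,
an action of `G` on `V` over `X₁` (along `r = π ≫ q`) making `π` equivariant, and a NODE ATLAS. [OURS · L1 W4.5c] -/
structure GModel where
  /-- the model -/
  V : Scheme.{0}
  /-- the structure morphism to `X′` -/
  π : V ⟶ X'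
  /-- the structure morphism to the base `X₁` -/
  r : V ⟶ X₁
  r_eq : r = π ≫ q
  /-- the action over the base -/
  act : ActionOver r G
  isProper : IsProper π
  isBirational : IsBirational π
  isIntegral : IsIntegral V
  isLocallyNoetherian : IsLocallyNoetherian V
  comm : ∀ g : G, (act.aut g).hom ≫ π = π ≫ (ρ g).hom
  atlas : NodeAtlas p act g₀

namespace GModel

variable {p q G ρ g₀}

/-- **Terminal model**: every point lies in a `G`-stable affine open, affine over the base, whose RING OF INVARIANTS
is a tame root chart (the local END state; H1 REES KILL / H2 UNIT DESCENT produce it from killed / exited nodes).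
[OURS · L1 W4.5c] -/
def Terminal (M : GModel p q G ρ g₀) : Prop :=
  ∀ v : M.V, ∃ O : M.act.StableAffineOpens, v ∈ O.1 ∧ IsAffineOpen O.1 ∧
    IsTameRootChart ↥((M.act.restrict O.1 O.2.1).invariantsRing ⊤)

/-- `M′` **is a move of** `M` along the centre `(𝒦, d)`: a blow-up `π′ : M′.V → M.V` of `𝒦.ideal d` over which the
structure maps and the actions are compatible. [OURS · L1 W4.5c] -/
def IsMoveOf (M M' : GModel p q G ρ g₀) (𝒦 : ReesFiltration M.V) (d : ℕ) : Prop :=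
  ∃ π' : M'.V ⟶ M.V, IsBlowup π' (𝒦.ideal d) ∧ M'.π = π' ≫ M.π ∧ M'.r = π' ≫ M.r ∧
    ∀ g : G, (M'.act.aut g).hom ≫ π' = π' ≫ (M.act.aut g).hom

/-- **The initial model** `V = X′` from a node atlas on `X′` for the action `ρ` over `X₁`. -/
def initial (hq : ∀ g : G, (ρ g).hom ≫ q = q) [IsIntegral X'] [IsLocallyNoetherian X']
    (h : NodeAtlas p (⟨ρ, hq⟩ : ActionOver q G) g₀) : GModel p q G ρ g₀ where
  V := X'
  π := 𝟙 X'
  r := q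
  r_eq := (Category.id_comp q).symm
  act := ⟨ρ, hq⟩
  isProper := inferInstance
  isBirational := ⟨⊤, by simp [dense_univ], by simp [dense_univ], inferInstance⟩
  isIntegral := inferInstance
  isLocallyNoetherian := inferInstance
  comm g := by rw [Category.comp_id, Category.id_comp]
  atlas := h

end GModel

/-- **(G5) END GLUING** — the pure gluing residue: if every point of `V` lies in a `G`-stable affine open, affine over
the separated base, whose ring of invariants is a tame root chart, then the glued quotient `V/G` (tree
`ActionOver.glued`) is locally tame-root-regular. [OURS · L1 W4.5c] -/
def EndGluing : Prop :=
  ∀ (V Y : Scheme.{0}) (r : V ⟶ Y) (G : Type) [Group G] [Finite G] [Y.IsSeparated] [IsSeparated r]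
    (act : ActionOver r G),
    (∀ v : V, ∃ O : act.StableAffineOpens, v ∈ O.1 ∧ IsAffineOpen O.1 ∧
      IsTameRootChart ↥((act.restrict O.1 O.2.1).invariantsRing ⊤)) →
    LocallyTameRootRegular act.glued

/-- **(G6) STRATEGY = the TERMINATION CRUX in scheme language**: a measure `μ` on `G`-models and, for every
non-terminal model, an admissible centre (H4b) all of whose moves (realised as models) strictly decrease `μ`.
[OURS · L1 W4.5c] -/
def Strategy : Prop :=
  ∃ μ : GModel p q G ρ g₀ → ℕ, ∀ M : GModel p q G ρ g₀, ¬ M.Terminal →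
    ∃ (𝒦 : ReesFiltration M.V) (d : ℕ), IsAdmissibleCentre p M.act g₀ 𝒦 d ∧
      ∀ M' : GModel p q G ρ g₀, M.IsMoveOf M' 𝒦 d → μ M' < μ M

variable {p q G ρ g₀}

/-- One move, re-packaged as a model. -/
theorem exists_isMoveOf (hmove : MoveStep.{0} p) (hG : ∀ g : G, g ∈ Subgroup.zpowers g₀)
    (M : GModel p q G ρ g₀) {𝒦 : ReesFiltration M.V} {d : ℕ}
    (h𝒦 : IsAdmissibleCentre p M.act g₀ 𝒦 d) : ∃ M' : GModel p q G ρ g₀, M.IsMoveOf M' 𝒦 d := by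
  obtain ⟨V', π', ρ', hbl, hprop, hbir, hint, hnoeth, hcomm, hatlas⟩ :=
    hmove M.V X₁ M.r G M.act g₀ hG 𝒦 d M.isIntegral M.isLocallyNoetherian h𝒦
  haveI := M.isProper
  haveI := hprop
  let M' : GModel p q G ρ g₀ :=
    { V := V'
      π := π' ≫ M.π
      r := π' ≫ M.r
      r_eq := by rw [M.r_eq, Category.assoc]
      act := ρ'
      isProper := inferInstance
      isBirational := ComponentGluing.IsBirational.comp hbir M.isBirational
      isIntegral := hint
      isLocallyNoetherian := hnoeth
      comm := fun g => by rw [← Category.assoc, hcomm g, Category.assoc, M.comm g, Category.assoc]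
      atlas := hatlas }
  exact ⟨M', π', hbl, rfl, rfl, hcomm⟩

/-- A terminal model is a KILL-TAME model, given the END gluing. -/
theorem killTameModel_of_terminal [Finite G] [X₁.IsSeparated] [IsSeparated q] (hend : EndGluing)
    (M : GModel p q G ρ g₀) (hM : M.Terminal) : KillTameModel q G ρ := by
  obtain ⟨V, π, r, hr, act, hprop, hbir, hint, hnoeth, hcomm, hatlas⟩ := M
  subst hr
  haveI := hprop
  haveI : IsSeparated (π ≫ q) := inferInstance
  exact ⟨V, π, inferInstance, inferInstance, act, hprop, hbir, hint, locallyDiagonalRootRegular_of_nodeAtlas hatlas,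
    hcomm, exists_stableAffineOpens_of_nodeAtlas hatlas, hend V X₁ (π ≫ q) G act hM⟩

/-- **THE `KillTameModel` ASSEMBLY**: MOVE (H4c/H4d, from the chart residue) + END GLUING (G5) + a STRATEGY (G6,
the termination crux) + an initial model ⇒ a KILL-TAME model (D2-T `S1.KillTameModel`). Strong induction on `μ`. -/
theorem killTameModel_of [Finite G] [X₁.IsSeparated] [IsSeparated q] (hG : ∀ g : G, g ∈ Subgroup.zpowers g₀)
    (hmove : MoveStep.{0} p) (hend : EndGluing)
    (hstrat : Strategy p q G ρ g₀) (M₀ : GModel p q G ρ g₀) : KillTameModel q G ρ := by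
  obtain ⟨μ, hμ⟩ := hstrat
  suffices h : ∀ n : ℕ, ∀ M : GModel p q G ρ g₀, μ M = n → KillTameModel q G ρ from h (μ M₀) M₀ rfl
  intro n
  induction n using Nat.strong_induction_on with
  | _ n ih =>
    intro M hn
    by_cases hT : M.Terminal
    · exact killTameModel_of_terminal hend M hT
    · obtain ⟨𝒦, d, h𝒦, hdec⟩ := hμ M hT
      obtain ⟨M', hM'⟩ := exists_isMoveOf hmove hG M h𝒦
      exact ih (μ M') (hn ▸ hdec M' hM') M' rfl

/-- The same from the chart residue (G1) in place of the move (H4d `moveStep_of_blowupNodeAtlas`). -/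
theorem killTameModel_of_blowupNodeAtlas [Finite G] [X₁.IsSeparated] [IsSeparated q]
    (hG : ∀ g : G, g ∈ Subgroup.zpowers g₀)
    (hcharts : BlowupNodeAtlas.{0} p) (hend : EndGluing) (hstrat : Strategy p q G ρ g₀)
    (M₀ : GModel p q G ρ g₀) : KillTameModel q G ρ :=
  killTameModel_of hG (moveStep_of_blowupNodeAtlas hcharts) hend hstrat M₀

end Summit.ResolutionOfSingularities.ResolutionOfSingularities.Theorems.WildQuotientResolution.S1.GameFrame

end
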